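import Summits.QuantumFields.BalabanUV.T4Continuum.Support.B13Carriers
import Summits.QuantumFields.BalabanUV.T4Continuum.Support.ClusterRepDecay
import Literature.MathematicalPhysics.QuantumFieldTheory.Balaban1983to89.TreeLengthTorusGeometry

/-!
# NE5 ∕ U3, route P2 — the activity route's cluster representation INSTANTIATED ON BAŁABAN's LOCALIZATION DOMAINS
# (`B13Carriers.TwoRuns.carriers`, the row-O1-a artefact in the tree, p207668): the `DomainGeometry` of the paired torus domains, and leaves L08 (DecayExtract, PinBudget)
# PROVED ∕ L03 (KPInflated) PROVED MODULO the (2.38)-shaped majorant and two explicit inequalities — with (1.26), (2.27), (2.30) and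
# footprint locality THEOREMS of the tree's torus geometry (`TreeLengthTorusGeometry.tgeometry`), not hypotheses
# (skeleton `t4/skeletons/NE5-t4-ne5-p2.md` §5 rows O1′ R-rep ∕ R-KP, supplier rows after O1-a)

Cell `pub-balaban`, unit `b2b-balaban-t4-ne5-p2-g17` (T⁴ fan-out NE5 ∕ node U3, PROVER seat P2 «polymer-activity Lipschitz route»).
Summits-side new work under the LEAN PLACEMENT RULE (cell modelling + bookkeeping; NOT a Literature module).  HONEST FRAMING: rung
(B)+1 of the FINITE-VOLUME T⁴ continuum programme — NOT infinite volume, NOT a mass gap, NOT the Clay problem, NOT a proof of NE5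
(NOT PRINTED in [Balaban1987RG1]–[Balaban1989LargeFieldII]; they print ε-UNIFORM bounds, never η-RATES).  HONEST DEPENDENCY (cell
line, verbatim): continuum YM on T⁴ ⇐ BetaPertH ∧ nine spine estimates (0/9 proved); BetaPertH ⇐ (D1) ∧ (D4) ∧ CAP+tail; G-an2-4
gates asym, D1 and NE2/3/4.

WHAT THIS FILE DOES.  `B13Carriers.TwoRuns.carriers R : Carriers` (the row-O1-a artefact p207668 ACCEPTED e560c4f1bc36 — the O1-a
INSTANCE OF RECORD is the row owner's to rule, `t4/formal/NE5/LEAVES.md` v1.2; this file is the S-sized ADAPTER for the `TwoRuns` interface,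
a twin adapter for leaf-05's `b13Carriers` interface is staged) indexes the paired runs' localization domains by
`R.carriers.Dom = Σ j : ℕ, TDom 4 (R.cubesPerDir j)` (torus domains of every creation step), footprint `X.2.1`, tree length `torusTreeLen X.2.1`.  Here:
* §1 the SIGMA CUBE TYPE `SCube R = Σ j, TPt 4 (R.cubesPerDir j)`, the fibrewise wall adjacency `SAdj` (symmetric, decidable), the
  embedded footprints `footprint X = X.cubes ↦ Σ`, the touching relation `touch` (= ζ of (2.11): share a cube or a wall, fibrewise)
  and the finite catalogues `R.domAt k` (= 𝐃_k, the image of `TDom 4 N_k`);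
* §2 **`domainGeometry R : DomainGeometry R.carriers (SCube R)`** and the route's representation
  **`clusterRep R ρA ρB := (domainGeometry R).clusterRep ρA ρB`** — leaf L01's carrier ON BAŁABAN's DOMAINS (the activity families
  `ρA ρB` = NODE O's term rows, by `Realizes`);
* §3 the GEOMETRIC INPUTS of leaves L03 ∕ L08 as THEOREMS for these domains, transported from `TreeLengthTorusGeometry.tgeometry 4 N_k`
  (every field PROVED there): (1.26) `ineq126_level` (κ₀ = 64·log 162, K₀ = K₀(64, 8)), (2.30) `volBound_level` (c₁ = 64), (2.27)
  `ineq227_level` (c = 5), footprint locality `loc_b13` ∕ `reach_b13` (ν = 9);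
* §4 the leaves: **`decayExtract_b13`** (L08a: `DecayExtract (σ(d + 5)) (σd + 5σ)`, PROVED, any σ ≥ 0), **`pinBudget_b13`** (L08b:
  `PinBudget (τ·#cubes) (σ(d + 5)) (64τ·e^{−5σ}) κ`, PROVED for κ + 1 ≤ σ), **`kpInflated_b13`** (L03: `KPInflated (b13ClusterRep ρA ρB) W m
  s (τ·#cubes) (σd + 5σ)` (for `clusterRep R ρA ρB`) from ONLY the displayed (2.38)-SHAPED majorant `m ≤ A·e^{−R·d}` on every 𝐃_k (hypothesis SHAPE, locator
  [Balaban1988RG2Cluster] Lemma 3 (2.38) p. 20 — NOT asserted) and the two explicit inequalities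
  `64·log 162 + σ + 64τ ≤ R`, `(1 + s)·A·e^{5σ+64τ}·K₀(64,8)·9 ≤ τ` — cell `SMALLNESS.md`).
So on Bałaban's domain carriers the activity route's combinatorial leaves are no longer binders: L08 is a theorem, L03 is «(2.38)
majorant + two numbers».  NOT done here: the activity families ∕ term model (NODE O rows O1-b∕c∕d), W1, numerics.  0 sorry.
-/

noncomputable section

open scoped BigOperators

namespace Summit.QuantumFields.BalabanUV.T4Continuum.B13DomainGeometryTR

open Literature.MathematicalPhysics.QuantumFieldTheory.Balaban1983to89
open Literature.MathematicalPhysics.QuantumFieldTheory.Balaban1983to89.T4OutputRate (Carriers)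
open Literature.MathematicalPhysics.QuantumFieldTheory.Balaban1983to89.T4Continuum (T4Family)
open Literature.MathematicalPhysics.QuantumFieldTheory.Balaban1983to89.TreeLengthTorus (TPt TAdj TDom torusTreeLen)
open Literature.MathematicalPhysics.QuantumFieldTheory.Balaban1983to89.TreeLengthTorusGeometry
  (TTouch treach mem_treach tloc_of_touch card_treach_le tgeometry tgeometry_consts_four tgeometry_cubes)
open Literature.MathematicalPhysics.QuantumFieldTheory.Balaban1983to89.T4ActivityRecursion (KPInflated)
open Literature.MathematicalPhysics.QuantumFieldTheory.Balaban1983to89.B13FamilySum (Ineq126 VolBound Ineq227 coveringFamilies)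
open Summit.QuantumFields.BalabanUV.T4Continuum.B13Carriers (TwoRuns)
open Summit.QuantumFields.BalabanUV.T4Continuum.ClusterRepOfDomains (DomainGeometry)
open Summit.QuantumFields.BalabanUV.T4Continuum.ClusterRepKP (kpInflated_of_majorant)
open Summit.QuantumFields.BalabanUV.T4Continuum.ClusterRepDecay (decayExtract_of_ineq227 pinBudget_of_volBound)

variable {G : Type} [GaugeGroup G] (R : TwoRuns G)

/-! ## §1 Sigma cubes, fibrewise adjacency, embedded footprints, the touching relation, the catalogues -/

/-- [folklore] The cubes of ALL scales: a creation step `j ≤ K` with a cube index of `π_j`. -/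
abbrev SCube : Type := Σ j : ℕ, TPt 4 (R.cubesPerDir j)

/-- [folklore] Fibrewise wall adjacency of sigma cubes: same scale and torus-adjacent there. -/
def SAdj : SCube R → SCube R → Prop
  | ⟨j, a⟩, ⟨j', b⟩ => ∃ h : j = j', TAdj (h ▸ a) b

variable {R}

/-- [folklore] Torus wall adjacency of cube indices is decidable (finite existential over the four directions). -/
instance instDecTAdj {N : ℕ} : DecidableRel (TAdj (d := 4) (N := N)) := fun a b => by
  unfold TAdj; infer_instance

/-- [folklore] The carriers' domain index has decidable equality (it IS `R.Dom`, the tree's `TwoRuns.instDecidableEqDom`). -/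
instance instDecEqCarriersDom : DecidableEq R.carriers.Dom := show DecidableEq (TwoRuns.Dom R) from inferInstance

/-- [folklore] In one fibre `SAdj` is the torus adjacency. -/
theorem sAdj_mk_iff {j : ℕ} {a b : TPt 4 (R.cubesPerDir j)} :
    SAdj R ⟨j, a⟩ ⟨j, b⟩ ↔ TAdj a b :=
  ⟨fun ⟨_, h⟩ => h, fun h => ⟨rfl, h⟩⟩

/-- [folklore] `SAdj` forces equal scales. -/
theorem fst_eq_of_sAdj {x y : SCube R} (h : SAdj R x y) : x.1 = y.1 := by
  obtain ⟨j, a⟩ := x; obtain ⟨j', b⟩ := y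
  obtain ⟨h, _⟩ := h
  exact h

/-- [folklore] `SAdj` is symmetric. -/
theorem SAdj.symm {x y : SCube R} (h : SAdj R x y) : SAdj R y x := by
  obtain ⟨j, a⟩ := x; obtain ⟨j', b⟩ := y
  obtain ⟨h, hab⟩ := h
  subst h
  exact ⟨rfl, hab.symm⟩

/-- [folklore] `SAdj` is decidable. -/
instance instDecSAdj : DecidableRel (SAdj R) := fun x y =>
  match x, y with
  | ⟨j, a⟩, ⟨j', b⟩ =>
    if h : j = j' then by
      subst h
      exact decidable_of_iff (TAdj a b) sAdj_mk_iff.symm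
    else isFalse fun ⟨h', _⟩ => h h'

variable (R) in
/-- [folklore] The embedding of the cubes of `π_j` into the sigma cube type. -/
def embed (j : ℕ) : TPt 4 (R.cubesPerDir j) ↪ SCube R where
  toFun := fun c => ⟨j, c⟩
  inj' := fun _ _ h => eq_of_heq (Sigma.mk.inj h).2

/-- [folklore] `embed j c = ⟨j, c⟩`. -/
@[simp] theorem embed_apply (j : ℕ) (c : TPt 4 (R.cubesPerDir j)) : embed R j c = ⟨j, c⟩ := rfl

/-- [folklore] The embedded FOOTPRINT of a domain. -/
def footprint (X : R.carriers.Dom) : Finset (SCube R) := X.2.1.map (embed R X.1)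

/-- [folklore] Membership in an embedded footprint. -/
theorem mem_footprint {X : R.carriers.Dom} {c : SCube R} : c ∈ footprint X ↔ ∃ q ∈ X.2.1, (⟨X.1, q⟩ : SCube R) = c := by
  simp [footprint]

/-- [folklore] Membership in the embedded footprint of `⟨j, Y⟩`. -/
theorem mem_footprint_mk {j : ℕ} {Y : TDom 4 (R.cubesPerDir j)} {c : SCube R} :
    c ∈ footprint (⟨j, Y⟩ : R.carriers.Dom) ↔ ∃ q ∈ Y.1, (⟨j, q⟩ : SCube R) = c :=
  mem_footprint

/-- [folklore] A fibre cube lies in the footprint of a domain of its own scale iff it is one of its cubes. -/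
theorem mk_mem_footprint_iff {j : ℕ} {Y : TDom 4 (R.cubesPerDir j)} {q : TPt 4 (R.cubesPerDir j)} :
    (⟨j, q⟩ : SCube R) ∈ footprint (⟨j, Y⟩ : R.carriers.Dom) ↔ q ∈ Y.1 := by
  rw [mem_footprint_mk]
  constructor
  · rintro ⟨q', hq', h⟩
    have hqq : q' = q := eq_of_heq (Sigma.mk.inj h).2
    subst hqq
    exact hq'
  · intro hq
    exact ⟨q, hq, rfl⟩

/-- [folklore] The scale of every cube of a footprint is the domain's. -/
theorem fst_eq_of_mem_footprint {X : R.carriers.Dom} {c : SCube R} (h : c ∈ footprint X) : c.1 = X.1 := by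
  obtain ⟨q, _, rfl⟩ := mem_footprint.1 h
  rfl

/-- [folklore] The embedded footprint has the cardinality of the footprint. -/
theorem card_footprint (X : R.carriers.Dom) : (footprint X).card = X.2.1.card := Finset.card_map _

/-- [folklore] The embedded footprint is nonempty. -/
theorem footprint_nonempty (X : R.carriers.Dom) : (footprint X).Nonempty := by
  simpa [footprint] using X.2.2.1

/-- [folklore] THE TOUCHING RELATION ON FOOTPRINTS (ζ = 0 of (2.11): share a cube, or a pair of wall-adjacent cubes of one scale). -/
def touch (Fs Gs : Finset (SCube R)) : Prop := ∃ a ∈ Fs, ∃ b ∈ Gs, a = b ∨ SAdj R a b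

/-- [folklore] `touch` is decidable. -/
instance instDecTouch : DecidableRel (touch (R := R)) := fun _ _ => by
  unfold touch; infer_instance

/-- [folklore] `touch` is symmetric. -/
theorem touch_symm (Fs Gs : Finset (SCube R)) (h : touch Fs Gs) : touch Gs Fs := by
  obtain ⟨a, ha, b, hb, hab⟩ := h
  refine ⟨b, hb, a, ha, ?_⟩
  rcases hab with hab | hab
  · exact Or.inl hab.symm
  · exact Or.inr hab.symm

/-- [folklore] Overlapping footprints touch. -/
theorem touch_of_inter (Fs Gs : Finset (SCube R)) (h : (Fs ∩ Gs).Nonempty) : touch Fs Gs := by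
  obtain ⟨a, ha⟩ := h
  rw [Finset.mem_inter] at ha
  exact ⟨a, ha.1, a, ha.2, Or.inl rfl⟩

variable (R) in
/-- [folklore] The embedding of the scale-`j` torus domains into the common index `R.carriers.Dom` (the tree's `Function.Embedding.sigmaMk`). -/
def domEmb (j : ℕ) : TDom 4 (R.cubesPerDir j) ↪ R.carriers.Dom :=
  @Function.Embedding.sigmaMk ℕ (fun i => TDom 4 (R.cubesPerDir i)) j

/-- [folklore] `domEmb j Z = ⟨j, Z⟩`. -/
@[simp] theorem domEmb_apply (j : ℕ) (Z : TDom 4 (R.cubesPerDir j)) : domEmb R j Z = ⟨j, Z⟩ := rfl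

/-- [folklore] The catalogue 𝐃_k of the tree (`TwoRuns.domAt`) IS the image of the torus domains of scale `k` (definitional). -/
theorem domAt_eq_map (k : ℕ) :
    R.domAt k = (Finset.univ : Finset (TDom 4 (R.cubesPerDir k))).map (domEmb R k) := rfl

/-- [folklore] A subfamily of `domAt k` is the image of its PULL-BACK to the torus domains of scale `k`. -/
theorem eq_map_pullback {k : ℕ} {D : Finset R.carriers.Dom} (hD : D ⊆ R.domAt k) :
    D = (Finset.univ.filter fun Z : TDom 4 (R.cubesPerDir k) => (⟨k, Z⟩ : R.carriers.Dom) ∈ D).map (domEmb R k) := by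
  ext X
  rw [Finset.mem_map]
  constructor
  · intro hX
    have hXk := hD hX
    rw [domAt_eq_map, Finset.mem_map] at hXk
    obtain ⟨Z, -, rfl⟩ := hXk
    exact ⟨Z, Finset.mem_filter.2 ⟨Finset.mem_univ _, hX⟩, rfl⟩
  · rintro ⟨Z, hZ, rfl⟩
    exact (Finset.mem_filter.1 hZ).2

/-! ## §2 The domain geometry and the cluster representation of the activity route ON BAŁABAN's DOMAINS -/

section Geometry

variable (R) in
/-- [folklore] **THE DOMAIN GEOMETRY OF BAŁABAN's PAIRED TORUS DOMAINS** (row O1′ R-rep instantiated on the `TwoRuns` carriers). -/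
def domainGeometry : DomainGeometry R.carriers (SCube R) where
  cubes := fun X => footprint X
  level := R.domAt
  mem_level := fun _ _ => R.mem_domAt
  touch := touch
  touch_symm := touch_symm
  touch_of_inter := touch_of_inter
  cubes_nonempty := fun Y => footprint_nonempty Y

variable (R) in
/-- [folklore] **THE ACTIVITY ROUTE's CLUSTER REPRESENTATION ON BAŁABAN's DOMAINS** (leaf L01's carrier; the activity families
`ρA ρB` are NODE O's term rows, through `InputModel.Realizes`). -/
def clusterRep (ρA ρB : (ℕ → ℝ) → R.carriers.BgB → R.carriers.Dom → ℂ) : T4ActivityLipschitz.ClusterRep R.carriers :=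
  (domainGeometry R).clusterRep ρA ρB

/-! ## §3 The geometric inputs of L03 ∕ L08 as THEOREMS on Bałaban's domains (transported from `tgeometry 4 N_k`) -/

/-- [folklore] The reach of a domain: the torus reach of its footprint, embedded. -/
def reach (Z : R.carriers.Dom) : Finset (SCube R) := (treach Z.2).map (embed R Z.1)

/-- [folklore] FOOTPRINT LOCALITY ON BAŁABAN's DOMAINS: a touching domain contains a cube of the reach. -/
theorem loc_b13 (Z Z' : R.carriers.Dom) (h : touch (footprint Z') (footprint Z)) : ∃ q ∈ reach Z, q ∈ footprint Z' := by
  obtain ⟨j, A⟩ := Z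
  obtain ⟨j', B⟩ := Z'
  obtain ⟨a, ha, b, hb, hab⟩ := h
  obtain ⟨qa, hqa, rfl⟩ := mem_footprint_mk.1 ha
  obtain ⟨qb, hqb, rfl⟩ := mem_footprint_mk.1 hb
  -- both cases force `j' = j`
  have hjj : j' = j := by
    rcases hab with hab | hab
    · exact congrArg Sigma.fst hab
    · exact fst_eq_of_sAdj hab
  subst hjj
  have htt : TTouch B A := by
    refine ⟨qa, hqa, qb, hqb, ?_⟩
    rcases hab with hab | hab
    · exact Or.inl (eq_of_heq (Sigma.mk.inj hab).2)
    · exact Or.inr (sAdj_mk_iff.1 hab)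
  obtain ⟨q, hq, hqB⟩ := tloc_of_touch htt
  exact ⟨⟨j', q⟩, Finset.mem_map.2 ⟨q, hq, rfl⟩, mk_mem_footprint_iff.2 hqB⟩

/-- [folklore] `#reach ≤ 9·#footprint` on Bałaban's domains (ν = 2·4 + 1). -/
theorem reach_b13 (Z : R.carriers.Dom) : ((reach Z).card : ℝ) ≤ 9 * ((footprint Z).card : ℝ) := by
  rw [reach, Finset.card_map, card_footprint]
  have h := card_treach_le (d := 4) Z.2
  norm_num at h
  exact h

/-- [folklore] **(2.30) ON BAŁABAN's DOMAINS** (every scale): `#cubes X ≤ 64·(1 + d(X))` — the tree's torus volume bound. -/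
theorem volBound_level (k : ℕ) : VolBound (R.domAt k) (fun X => footprint X) R.carriers.d 64 := by
  intro Y _
  rw [card_footprint]
  have h := (tgeometry 4 (R.cubesPerDir Y.1)).volBound Y.2 (Finset.mem_univ _)
  rw [(tgeometry_consts_four _).2.2] at h
  exact h

/-- [folklore] **(1.26) ON BAŁABAN's DOMAINS** (every scale, every cube): `Σ_{Y ∈ 𝐃_k, Y ∋ c} e^{−κ₀ d(Y)} ≤ K₀` with the torus
constants `κ₀ = 64·log 162`, `K₀ = K₀(64, 8)`. -/
theorem ineq126_level (k : ℕ) :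
    Ineq126 (R.domAt k) (fun X => footprint X) R.carriers.d (64 * Real.log 162) (B12TreeDecay.K₀ (4 * 2 ^ 4) (2 * 4)) := by
  intro c
  have hK₀ : 0 ≤ B12TreeDecay.K₀ (4 * 2 ^ 4) (2 * 4) := (B12TreeDecay.K₀_pos _ _).le
  rw [domAt_eq_map, Finset.filter_map, Finset.sum_map]
  by_cases hc : c.1 = k
  · obtain ⟨j, q⟩ := c
    simp only at hc
    subst hc
    have h := (tgeometry 4 (R.cubesPerDir j)).ineq126 q
    rw [(tgeometry_consts_four _).2.1] at h
    refine le_trans (le_of_eq ?_) h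
    refine Finset.sum_congr ?_ fun Z _ => rfl
    ext Z
    constructor
    · intro hZ
      exact Finset.mem_filter.2 ⟨Finset.mem_univ _, mk_mem_footprint_iff.1 (Finset.mem_filter.1 hZ).2⟩
    · intro hZ
      exact Finset.mem_filter.2 ⟨Finset.mem_univ _, mk_mem_footprint_iff.2 (Finset.mem_filter.1 hZ).2⟩
  · -- a cube of another scale lies in no footprint of scale `k`
    have hempty : (Finset.univ.filter fun Z : TDom 4 (R.cubesPerDir k) =>
        c ∈ footprint ((domEmb R k) Z)) = ∅ := by
      refine Finset.filter_false_of_mem fun Z _ hcZ => hc ?_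
      exact (fst_eq_of_mem_footprint hcZ).trans rfl
    simp only [Function.comp_def]
    rw [hempty, Finset.sum_empty]
    exact hK₀

/-- [folklore] **(2.27) ON BAŁABAN's DOMAINS** (every domain, its covering families within its scale, printed constant 5). -/
theorem ineq227_level (X : R.carriers.Dom) :
    Ineq227 (R.domAt (R.carriers.scale X)) (fun Y => footprint Y) R.carriers.d (footprint X) (R.carriers.d X) 5 := by
  intro D hD
  rw [B13FamilySum.mem_coveringFamilies] at hD
  obtain ⟨hDsub, hDcov⟩ := hD
  obtain ⟨k, A⟩ := X
  -- pull the family back to the torus domains of scale `k`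
  set D₀ : Finset (TDom 4 (R.cubesPerDir k)) := Finset.univ.filter fun Z => (⟨k, Z⟩ : R.carriers.Dom) ∈ D with hD₀
  have hDeq : D = D₀.map (domEmb R k) := eq_map_pullback hDsub
  have hcov₀ : D₀.biUnion (fun Z : TDom 4 (R.cubesPerDir k) => Z.1) = A.1 := by
    ext q
    rw [Finset.mem_biUnion]
    constructor
    · rintro ⟨Z, hZ, hqZ⟩
      have hq : (⟨k, q⟩ : SCube R) ∈ D.biUnion fun Y => footprint Y :=
        Finset.mem_biUnion.2 ⟨⟨k, Z⟩, (Finset.mem_filter.1 hZ).2, mk_mem_footprint_iff.2 hqZ⟩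
      rw [hDcov] at hq
      exact mk_mem_footprint_iff.1 hq
    · intro hq
      have hq' : (⟨k, q⟩ : SCube R) ∈ D.biUnion fun Y => footprint Y := by
        rw [hDcov]; exact mk_mem_footprint_iff.2 hq
      obtain ⟨Y, hYD, hqY⟩ := Finset.mem_biUnion.1 hq'
      have hY1 : Y.1 = k := (fst_eq_of_mem_footprint hqY).symm
      obtain ⟨j, Z⟩ := Y
      simp only at hY1
      subst hY1
      exact ⟨Z, Finset.mem_filter.2 ⟨Finset.mem_univ _, hYD⟩, mk_mem_footprint_iff.1 hqY⟩
  have hmemD₀ : D₀ ∈ coveringFamilies (Finset.univ : Finset (TDom 4 (R.cubesPerDir k)))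
      (tgeometry 4 (R.cubesPerDir k)).cubes ((tgeometry 4 (R.cubesPerDir k)).cubes A) :=
    B13FamilySum.mem_coveringFamilies.2 ⟨Finset.subset_univ _, by
      change D₀.biUnion (fun Z : TDom 4 (R.cubesPerDir k) => Z.1) = A.1
      exact hcov₀⟩
  have h227 := (tgeometry 4 (R.cubesPerDir k)).ineq227 A D₀ hmemD₀
  rw [hDeq, Finset.sum_map]
  exact h227.trans (le_of_eq (Finset.sum_congr rfl fun x _ => rfl))

/-! ## §4 The leaves on Bałaban's domains -/

/-- [folklore] **L08a PROVED ON BAŁABAN's DOMAINS**: decay extraction `DecayExtract (σ·(d + 5)) (σ·d + σ·5)` for the activity route's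
representation, from (2.27) as a THEOREM of the torus geometry (any `σ ≥ 0`). -/
theorem decayExtract_b13 (ρA ρB : (ℕ → ℝ) → R.carriers.BgB → R.carriers.Dom → ℂ) {σ : ℝ} (hσ : 0 ≤ σ) :
    (clusterRep R ρA ρB).DecayExtract (fun X => σ * (R.carriers.d X + 5)) (fun Z => σ * R.carriers.d Z + σ * 5) :=
  decayExtract_of_ineq227 (domainGeometry R) ρA ρB hσ fun X => ineq227_level X

/-- [folklore] **L08b PROVED ON BAŁABAN's DOMAINS**: the pin budget `PinBudget (τ·#cubes) (σ·(d + 5)) (τ·64·e^{−5σ}) κ` for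
`κ + 1 ≤ σ`, from (2.30) as a THEOREM of the torus geometry. -/
theorem pinBudget_b13 (ρA ρB : (ℕ → ℝ) → R.carriers.BgB → R.carriers.Dom → ℂ) {τ σ κ : ℝ} (hτ : 0 ≤ τ) (hσκ : κ + 1 ≤ σ) :
    (clusterRep R ρA ρB).PinBudget (fun Z => τ * ((footprint Z).card : ℝ)) (fun X => σ * (R.carriers.d X + 5))
      (τ * 64 * Real.exp (-(σ * 5))) κ :=
  pinBudget_of_volBound (domainGeometry R) ρA ρB (c := 5) hτ (by norm_num) hσκ volBound_level

/-- [folklore] **L03 ON BAŁABAN's DOMAINS, MODULO THE (2.38)-SHAPED MAJORANT AND TWO NUMBERS**: `KPInflated` for the activity route's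
representation from a nonnegative majorant `m ≤ A·e^{−R·d}` on every 𝐃_k (hypothesis SHAPE with locator Lemma 3 (2.38) p. 20 —
asserted nowhere), the rate room `64·log 162 + σ + 64τ ≤ R` and the smallness `(1 + s)·A·e^{5σ+64τ}·K₀(64,8)·9 ≤ τ`; (1.26), (2.30) and
footprint locality are THEOREMS of the torus geometry. -/
theorem kpInflated_b13 (ρA ρB : (ℕ → ℝ) → R.carriers.BgB → R.carriers.Dom → ℂ) {W : Set (ℕ → ℝ)}
    {m : (ℕ → ℝ) → R.carriers.BgB → R.carriers.Dom → ℝ} {A Rm τ σ s : ℝ}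
    (hA : 0 ≤ A) (hτ : 0 ≤ τ) (hσ : 0 ≤ σ) (hs : 0 ≤ s)
    (hm0 : ∀ g U Z, 0 ≤ m g U Z)
    (hm : ∀ g ∈ W, ∀ U (k : ℕ), ∀ Z ∈ R.domAt k, m g U Z ≤ A * Real.exp (-(Rm * R.carriers.d Z)))
    (hrate : 64 * Real.log 162 + σ + τ * 64 ≤ Rm)
    (hsmall : (1 + s) * A * Real.exp (σ * 5 + τ * 64) * B12TreeDecay.K₀ (4 * 2 ^ 4) (2 * 4) * 9 ≤ τ) :
    KPInflated (clusterRep R ρA ρB) W m s (fun Z => τ * ((footprint Z).card : ℝ))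
      (fun Z => σ * R.carriers.d Z + σ * 5) :=
  kpInflated_of_majorant (domainGeometry R) ρA ρB reach R.carriers.d loc_b13 reach_b13
    R.carriers.d_nonneg hA (B12TreeDecay.K₀_pos _ _).le hτ hσ (mul_nonneg hσ (by norm_num)) hs hm0 hm ineq126_level
    volBound_level hrate hsmall

end Geometry

end Summit.QuantumFields.BalabanUV.T4Continuum.B13DomainGeometryTR

end
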